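import Mathlib
import HarnessLib
import Summits.HodgeConjecture.HodgeConjecture.Theses.HeckePrymWeil
import Literature.AlgebraicGeometry.Motives.HyperbolicWeilType
import Literature.AlgebraicGeometry.Motives.FamiliesVHS
import Literature.AlgebraicGeometry.Motives.AbelianVarietyProduct

/-!
# Sketch — crux-ideate stmt-HodgeConjecture-14496 (`HeckePrymAnchors`), round 1, ideator 1

First lemmas of the three idea cards, typed over existing declarations, plus the kernel-checked
reduction `heckePrymAnchors_of_splitAnchor` (card `split-discriminant-deligne-anchor`).
Nothing here is a proof of the crux; the `def … : Prop` are the statements the cards propose.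
-/

open CategoryTheory

namespace Summit.HodgeConjecture.HodgeConjecture.Cruxes.HeckePrymAnchors.IdeatorOne

open Literature.AlgebraicGeometry.Motives Literature.AlgebraicGeometry.HodgeTheory

noncomputable section

/-- The crux's typing of the Weil plane of `(X, Φ)` in degree `2k` for `K = ℚ(√-p)`:
the two eigenspaces of `(𝟙 + Φ)^*` for `(1 ± i√p)^{2k}`. -/
def weilSpan (p k : ℕ) (X : AbelianVariety ℂ) (Φ : X ⟶ X) :
    Submodule ℂ (complexBetti X.X (2 * k)) :=
  Module.End.eigenspace (complexBetti.map (𝟙 X + Φ).hom.hom.hom (2 * k)).hom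
      ((1 + Complex.I * (Real.sqrt (p : ℝ) : ℂ)) ^ (2 * k)) ⊔
    Module.End.eigenspace (complexBetti.map (𝟙 X + Φ).hom.hom.hom (2 * k)).hom
      ((1 - Complex.I * (Real.sqrt (p : ℝ) : ℂ)) ^ (2 * k))

/-- The crux's ANCHORING conclusion for one class `c ∈ H^{2k}(X(ℂ); ℂ)` of an abelian `2k`-fold
`X`: a smooth projective family of `√-p`-abelian `2k`-folds over a smooth irreducible base through
`X` (fibre `s₁`), a global class `W` on the total space with rational `(k,k)` fibre restrictions,
`e^*(W|_{s₁}) = c`, and `W|_{s₀}` algebraic (= supported in codimension `k`). Verbatim the crux's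
`∃`-clause with `(A.prod B)` generalised to `X`. -/
def IsAnchored (p k : ℕ) (X : AbelianVariety ℂ) (c : complexBetti X.X (2 * k)) : Prop :=
  ∃ (𝒳 S : SchemeOver ℂ) (f : 𝒳 ⟶ S) (s₁ s₀ : ComplexPoints S) (e : X.X ≅ fiberOver f s₁)
    (W : complexBetti 𝒳 (2 * k)),
    IsSmoothProjectiveFamily f (2 * k) ∧ IrreducibleSpace S.left ∧ AlgebraicGeometry.Smooth S.hom ∧
    (∀ s : ComplexPoints S,
      IsRationalClass (complexBetti.map (fiberι f s) (2 * k) W) ∧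
      IsOfHodgeType (2 * k) (fiberOver f s) (2 * k) k k (complexBetti.map (fiberι f s) (2 * k) W)) ∧
    (∀ s : ComplexPoints S, ∃ (A' : AbelianVariety ℂ) (φ' : A' ⟶ A'),
      A'.dim = (2 * k) ∧ φ' ≫ φ' = -((p : ℤ) • 𝟙 A') ∧ Nonempty (A'.X ≅ fiberOver f s)) ∧
    complexBetti.map e.hom (2 * k) (complexBetti.map (fiberι f s₁) (2 * k) W) = c ∧
    complexBetti.map (fiberι f s₀) (2 * k) W ∈ algebraicClasses (fiberOver f s₀) k

/-- Every rational `(k,k)` class in the Weil plane of `(X, Φ)` is anchored. -/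
def WeilAnchored (p k : ℕ) (X : AbelianVariety ℂ) (Φ : X ⟶ X) : Prop :=
  ∀ c : complexBetti X.X (2 * k), IsRationalClass c → IsOfHodgeType (2 * k) X.X (2 * k) k k c →
    c ∈ weilSpan p k X Φ → IsAnchored p k X c

/-- The crux's Weil-surface clause for `(B, ψ)`: dimension 2, `ψ² = -p`, and a NON-ZERO rational
`(1,1)` class in its Weil plane (forces `K`-signature `(1,1)`). -/
def IsWeilSurface (p : ℕ) (B : AbelianVariety ℂ) (ψ : B ⟶ B) : Prop :=
  B.dim = 2 ∧ ψ ≫ ψ = -((p : ℤ) • 𝟙 B) ∧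
    ∃ b : complexBetti B.X (2 * 1), b ≠ 0 ∧ IsRationalClass b ∧
      IsOfHodgeType (2 * 1) B.X (2 * 1) 1 1 b ∧ b ∈ weilSpan p 1 B ψ

/-- `(A, φ)` carries a non-zero rational `(n,n)` Weil class — on the carriers this is "of Weil
type `(n,n)`" (Deligne–Milne Prop. 4.4 / Moonen–Zarhin Criterion 1: all of `W_K` is Hodge iff the
`K`-signature is balanced, else `0` is its only Hodge class). -/
def HasWeilHodgeClass (p n : ℕ) (A : AbelianVariety ℂ) (φ : A ⟶ A) : Prop :=
  ∃ c : complexBetti A.X (2 * n), c ≠ 0 ∧ IsRationalClass c ∧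
    IsOfHodgeType (2 * n) A.X (2 * n) n n c ∧ c ∈ weilSpan p n A φ

/-- The `K`-symmetrised hyperplane class `h = p·ι^*a + Φ^*ι^*a` of a projective embedding (the
route's typing of "a `Φ`-compatible polarization class", item AimedDescending). -/
def symmetrisedClass (p : ℕ) (X : AbelianVariety ℂ) (Φ : X ⟶ X) (e : ProjectiveEmbedding X.X)
    (a : complexBetti (projectiveSpace e.n ℂ) 2) : complexBetti X.X 2 :=
  (p : ℂ) • complexBetti.map e.ι 2 a + complexBetti.map Φ.hom.hom.hom 2 (complexBetti.map e.ι 2 a)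

/-- `(X, Φ)` is SPLIT (hyperbolic) in degree `2k` for some `K`-symmetrised hyperplane class:
Witt index `k`, i.e. `det H = (-1)^k ∈ ℚ^×/Nm(K^×)` (van Geemen 5.2/5.4; Deligne–Milne Cor. 4.2). -/
def IsSplitFor (p k : ℕ) (X : AbelianVariety ℂ) (Φ : X ⟶ X) : Prop :=
  ∃ (e : ProjectiveEmbedding X.X) (a : complexBetti (projectiveSpace e.n ℂ) 2),
    IsRationalClass a ∧ a ≠ 0 ∧ IsHyperbolicWeilType X Φ k (symmetrisedClass p X Φ e a)

/-- The product endomorphism `φ × ψ` of `A × B`, written as in the crux. -/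
abbrev prodEnd {A B : AbelianVariety ℂ} (φ : A ⟶ A) (ψ : B ⟶ B) : A.prod B ⟶ A.prod B :=
  AbelianVariety.prodLift (AbelianVariety.fst A B ≫ φ) (AbelianVariety.snd A B ≫ ψ)

/-! ## Card `split-discriminant-deligne-anchor` — stubs and the checked reduction -/

/-- STUB S1 (AIMED WEIL SURFACE; Landherr + van Geemen 5.2–5.3, the `B_δ` of AimedDescending):
for every `(A, φ)` of dimension `2n` there is a CM Weil surface `(B, ψ)` with `A × B` of
dimension `2k = 2n+2`, `(φ×ψ)² = -p`, and — when `A` is of Weil type — `(A × B, φ × ψ)` SPLIT. -/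
def AimedSplitSurface : Prop :=
  ∀ p : ℕ, p.Prime → p % 4 = 3 → 7 ≤ p → ∀ n k : ℕ, k = n + 1 →
    ∀ (A : AbelianVariety ℂ) (φ : A ⟶ A), A.dim = (2 * n) → φ ≫ φ = -((p : ℤ) • 𝟙 A) →
      ∃ (B : AbelianVariety ℂ) (ψ : B ⟶ B), IsWeilSurface p B ψ ∧ (A.prod B).dim = (2 * k) ∧
        prodEnd φ ψ ≫ prodEnd φ ψ = -((p : ℤ) • 𝟙 (A.prod B)) ∧
        (HasWeilHodgeClass p n A φ → IsSplitFor p k (A.prod B) (prodEnd φ ψ))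

/-- STUB S2 (DELIGNE'S SPLIT ANCHOR — the lever; Deligne–Milne LNM 900 I, proof of Thm. 4.8
pp. 48–51 + Lemma 4.5 + Remark 4.10; Voisin II Thm. 4.18): on a SPLIT `√-p`-abelian `2k`-fold
every rational `(k,k)` Weil class is anchored — by the level-`3` Weil family `Γ\(X⁺ × V(ℝ)/V(ℤ))`
at a fibre isogenous to `A₀ ⊗_ℚ K`, where the Weil plane is spanned by the classes
`q_λ^*[pt_{A₀}]`, supported on codimension-`k` abelian-subvariety fibres. -/
def DeligneSplitAnchor : Prop :=
  ∀ p : ℕ, p.Prime → p % 4 = 3 → 7 ≤ p → ∀ k : ℕ, 1 ≤ k →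
    ∀ (X : AbelianVariety ℂ) (Φ : X ⟶ X), X.dim = (2 * k) → Φ ≫ Φ = -((p : ℤ) • 𝟙 X) →
      IsSplitFor p k X Φ → WeilAnchored p k X Φ

/-- STUB S3 (OFF WEIL TYPE THE CLASS IS ZERO; Deligne–Milne Prop. 4.4, Moonen–Zarhin Crit. 1,
signatures add under products): if `(A, φ)` has no non-zero rational `(n,n)` Weil class then
`(A × B, φ × ψ)` has no non-zero rational `(k,k)` Weil class. -/
def OffWeilTypeVanishing : Prop :=
  ∀ p : ℕ, p.Prime → p % 4 = 3 → 7 ≤ p → ∀ n k : ℕ, k = n + 1 →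
    ∀ (A : AbelianVariety ℂ) (φ : A ⟶ A) (B : AbelianVariety ℂ) (ψ : B ⟶ B),
      A.dim = (2 * n) → φ ≫ φ = -((p : ℤ) • 𝟙 A) → IsWeilSurface p B ψ →
      ¬ HasWeilHodgeClass p n A φ →
        ∀ c : complexBetti (A.prod B).X (2 * k), IsRationalClass c →
          IsOfHodgeType (2 * k) (A.prod B).X (2 * k) k k c →
          c ∈ weilSpan p k (A.prod B) (prodEnd φ ψ) → c = 0

/-- STUB S4 (CONSTANT FAMILY; Mumford AV §4/§6: abelian varieties are smooth projective): the
identity family `X → Spec ℂ` anchors the zero class. -/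
def ConstantFamilyAnchorsZero : Prop :=
  ∀ p k : ℕ, ∀ (X : AbelianVariety ℂ) (Φ : X ⟶ X), X.dim = (2 * k) →
    Φ ≫ Φ = -((p : ℤ) • 𝟙 X) → IsAnchored p k X 0

/-- CHECKED REDUCTION (pure logic): the four stubs imply the crux `HeckePrymAnchors` BY NAME. -/
theorem heckePrymAnchors_of_splitAnchor (h1 : AimedSplitSurface) (h2 : DeligneSplitAnchor)
    (h3 : OffWeilTypeVanishing) (h4 : ConstantFamilyAnchorsZero) :
    Summit.HodgeConjecture.HodgeConjecture.Theses.HeckePrymWeil.HeckePrymAnchors := by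
  intro p hp hp4 hp7 g hg n k hk hk' A φ hA hφ
  obtain ⟨B, ψ, hBW, hdim, hΦ, hsplit⟩ := h1 p hp hp4 hp7 n k hk A φ hA hφ
  refine ⟨B, ψ, hBW.1, hBW.2.1, hBW.2.2, ?_⟩
  intro c hc hH hW
  by_cases hcase : HasWeilHodgeClass p n A φ
  · exact h2 p hp hp4 hp7 k (by omega) (A.prod B) (prodEnd φ ψ) hdim hΦ (hsplit hcase) c hc hH hW
  · have h0 : c = 0 := h3 p hp hp4 hp7 n k hk A φ B ψ hA hφ hBW hcase c hc hH hW
    subst h0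
    exact h4 p k (A.prod B) (prodEnd φ ψ) hdim hΦ

/-! ## Card `diagonal-torus-decomposable-anchor` — first lemma (signature) -/

/-- The COMPANION Weil surface: on `E × E` (any elliptic curve `E`) the endomorphism
`ψ(x, y) = (-p·y, x)` — the companion matrix of `T² + p` — satisfies `ψ² = -p`; written with the
tree's `prodLift/fst/snd`. -/
def companionEnd (p : ℕ) (E : AbelianVariety ℂ) : E.prod E ⟶ E.prod E :=
  AbelianVariety.prodLift (AbelianVariety.snd E E ≫ (-((p : ℤ) • 𝟙 E))) (AbelianVariety.fst E E)

/-- `ψ ∘ ψ = -p` for the companion endomorphism (pure category algebra; provable now). -/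
def CompanionSquares : Prop :=
  ∀ (p : ℕ) (E : AbelianVariety ℂ),
    companionEnd p E ≫ companionEnd p E = -((p : ℤ) • 𝟙 (E.prod E))

theorem companionSquares : CompanionSquares := by
  intro p E
  unfold companionEnd
  apply AbelianVariety.prod_hom_ext
  · rw [Category.assoc, AbelianVariety.prodLift_fst, ← Category.assoc, AbelianVariety.prodLift_snd]
    simp
  · rw [Category.assoc, AbelianVariety.prodLift_snd, AbelianVariety.prodLift_fst]
    simp

/-- STUB (DIAGONAL-TORUS ANCHOR in the family of `X`'s OWN discriminant; Deligne–Milne proof of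
4.8 with the Landherr-diagonal CM point instead of `A₀ ⊗ K`; decomposability there by
Moonen–Zarhin 1998 Criterion 2, type IV, `m ≥ 2`: `θ = Tr_F|E₋ = k√-p - k√-p = 0`): every
`√-p`-abelian `2k`-fold carrying a non-zero rational `(k,k)` Weil class is Weil-anchored —
no splitness hypothesis, no discriminant bookkeeping. -/
def DiagonalTorusAnchor : Prop :=
  ∀ p : ℕ, p.Prime → p % 4 = 3 → 7 ≤ p → ∀ k : ℕ, 1 ≤ k →
    ∀ (X : AbelianVariety ℂ) (Φ : X ⟶ X), X.dim = (2 * k) → Φ ≫ Φ = -((p : ℤ) • 𝟙 X) →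
      HasWeilHodgeClass p k X Φ → WeilAnchored p k X Φ

/-- CHECKED REDUCTION for the diagonal-torus card: a Weil surface supply (no aiming needed), the
anchor, off-type vanishing and the constant family give the crux. -/
def WeilSurfaceSupply : Prop :=
  ∀ p : ℕ, p.Prime → p % 4 = 3 → 7 ≤ p → ∀ n k : ℕ, k = n + 1 →
    ∀ (A : AbelianVariety ℂ) (φ : A ⟶ A), A.dim = (2 * n) → φ ≫ φ = -((p : ℤ) • 𝟙 A) →
      ∃ (B : AbelianVariety ℂ) (ψ : B ⟶ B), IsWeilSurface p B ψ ∧ (A.prod B).dim = (2 * k) ∧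
        prodEnd φ ψ ≫ prodEnd φ ψ = -((p : ℤ) • 𝟙 (A.prod B))

/-- Product Weil type: a Weil–Hodge class on `A` and one on `B` give one on `A × B`
(external cup product; tree `WeilClassesProducts.cupProduct_map_map_mem_weilClassesPlus`). -/
def ProductHasWeilHodgeClass : Prop :=
  ∀ p : ℕ, p.Prime → p % 4 = 3 → 7 ≤ p → ∀ n k : ℕ, k = n + 1 →
    ∀ (A : AbelianVariety ℂ) (φ : A ⟶ A) (B : AbelianVariety ℂ) (ψ : B ⟶ B),
      A.dim = (2 * n) → IsWeilSurface p B ψ → HasWeilHodgeClass p n A φ →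
        HasWeilHodgeClass p k (A.prod B) (prodEnd φ ψ)

theorem heckePrymAnchors_of_diagonalTorus (h1 : WeilSurfaceSupply) (h2 : DiagonalTorusAnchor)
    (h2' : ProductHasWeilHodgeClass) (h3 : OffWeilTypeVanishing) (h4 : ConstantFamilyAnchorsZero) :
    Summit.HodgeConjecture.HodgeConjecture.Theses.HeckePrymWeil.HeckePrymAnchors := by
  intro p hp hp4 hp7 g hg n k hk hk' A φ hA hφ
  obtain ⟨B, ψ, hBW, hdim, hΦ⟩ := h1 p hp hp4 hp7 n k hk A φ hA hφ
  refine ⟨B, ψ, hBW.1, hBW.2.1, hBW.2.2, ?_⟩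
  intro c hc hH hW
  by_cases hcase : HasWeilHodgeClass p n A φ
  · exact h2 p hp hp4 hp7 k (by omega) (A.prod B) (prodEnd φ ψ) hdim hΦ
      (h2' p hp hp4 hp7 n k hk A φ B ψ hA hBW hcase) c hc hH hW
  · have h0 : c = 0 := h3 p hp hp4 hp7 n k hk A φ B ψ hA hφ hBW hcase c hc hH hW
    subst h0
    exact h4 p k (A.prod B) (prodEnd φ ψ) hdim hΦ

/-! ## Card `torsion-weight-eigenclass` — first lemma (signature) -/

/-- WEIGHT-`2k` EIGENCLASSES are determined by ONE fibre: if an `S`-endomorphism `m` of the total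
space (intended: multiplication by `N ≥ 2` on an abelian scheme `𝒳/S`, acting as `N^{2k}` on each
`H^{2k}(𝒳_s)`) fixes `W` up to the weight `N^{2k}`, and `W` dies on one fibre of the smooth
projective family over an irreducible base, then `W = 0`. (Leray degenerates for abelian schemes
by weights — Deninger–Murre 1991 / Beauville; the `N^{2k}`-eigenspace of `H^{2k}(𝒳)` IS the space
of flat sections of `R^{2k}f_*`, so this injectivity + the matching surjectivity replace the theorem
of the fixed part.) -/
def WeightEigenclassRigidity : Prop :=
  ∀ (k N : ℕ), 2 ≤ N → ∀ ⦃𝒳 S : SchemeOver ℂ⦄ (f : 𝒳 ⟶ S) (m : 𝒳 ⟶ 𝒳), m ≫ f = f →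
    IsSmoothProjectiveFamily f (2 * k) → IrreducibleSpace S.left →
    (∀ s : ComplexPoints S, ∃ (A' : AbelianVariety ℂ) (ι : A'.X ≅ fiberOver f s),
      ∀ i : ℕ, ∀ x : complexBetti (fiberOver f s) i,
        complexBetti.map (ι.inv ≫ ((N : ℤ) • 𝟙 A').hom.hom.hom ≫ ι.hom) i x = ((N : ℂ) ^ i) • x ∧
        fiberι f s ≫ m = (ι.inv ≫ ((N : ℤ) • 𝟙 A').hom.hom.hom ≫ ι.hom) ≫ fiberι f s) →
    ∀ W : complexBetti 𝒳 (2 * k), complexBetti.map m (2 * k) W = ((N : ℂ) ^ (2 * k)) • W →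
      ∀ s₀ : ComplexPoints S, complexBetti.map (fiberι f s₀) (2 * k) W = 0 → W = 0

end

end Summit.HodgeConjecture.HodgeConjecture.Cruxes.HeckePrymAnchors.IdeatorOne
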